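/-
Copyright (c) 2026 the pub-hodgecm-mathlib formalisation cell (harness21).  Dealer seat hodgecm-mathlib-LH4-plan (g10), req618 STAGE 1a «(D-RAM) FOUR-FRAME» squad
(director s1808∕s1809; LEAD T17-27 DIRECTIVE b9ecbbedecc9c5ae + v1.1 d3f1616d0136e728 (D2′)(R-5)(R-6)(R-7)): the SUMMIT-SIDE sorry-free DEFS LEAF №2b of the line
`Cruxes/H413/Lines/F0_P3c_DyRamFourFrame.lean` — the (ii-G) CENSUS DICTIONARY Prop `AnchorCountDictionary t` (GATE 1a-1 (D-G), v1 = v1.3 VERBATIM), as `def … : Prop` ONLY.  2026-09-03.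
-/
import Literature.NumberTheory.Automorphic.UnitaryThreeFourFrameDefs                      -- ★ g10-#0a (p854559): §H tokens, `IsRamifiedQuadraticDatum`, `IsElementDatum`, P1∕P2
import Literature.NumberTheory.Rogawski1990.LocalTransferIdentityCoreDyadicDescent        -- (leaf import) the organ's vocabulary
import Literature.NumberTheory.Rogawski1990.ShalikaGermExpansionUnitaryThreeNonsplitCM     -- (leaf import) `ShalikaGermExpansionNonsplit`
import Literature.NumberTheory.Rogawski1990.LocalTransferAtOneOfShalikaRankUnramifiedAll   -- (leaf import) ★ `cmLocalIntegralLevel`, `localNonsplitEquiv`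
import Literature.NumberTheory.Rogawski1990.LocalTransferAtOneOfPopulations                -- ★ `localTransferAtOne_of_populations` and its row-clause tokens
import Literature.NumberTheory.Automorphic.LocalUnitaryGroupCongr                          -- (leaf import) ★ `galAdicCompletionMap`-side congruences
import HarnessLib

/-!
# F0 · P3c · line LH4 «(D-RAM) FOUR-FRAME» — DEFS LEAF №2b: the (ii-G) CENSUS DICTIONARY Prop `AnchorCountDictionary t` (GATE 1a-1 (D-G), v1 = v1.3 VERBATIM)

Cell `pub/hodgecm-mathlib`, crux H413 = `stmt-HodgeConjecture-24833` (helper lane `--supports stmt-HodgeConjecture-24833 --as helper`), route HCCMUnconditional;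
dealer LH4-plan (g10) deal g10-#0b №2b (WORD #5 2026-09-03), filed by LH4-p03 (g11).  DEF LANE: `def … : Prop` ONLY — NO theorem, NO instance, NO notation,
NO `sorry`, NO named fact, NO `set_option`.  WHY A TREE MODULE (T11-93): the LAYER-2 support theorems of the line (LEAD T17-29 (R-7)) conclude∕consume these Props
BY NAME — they must live in a sorry-free tree module, never in the sorried line file.

CONTENTS.  `AnchorCountDictionary t` — GATE 1a-1 `LAWSOCKET-DRAM-FourFrame` (F0P3a-p01 (g30)) §2 (D-G), byte-equal in v1 69c2296bf1a50ec9 ∕ v1.1 ∕ v1.2 ∕ v1.3 1cde7480e16e7c30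
(l. 300–334), read by REF1 (g33) m09 ∕ REF1 (g19) m10 ∕ LHref-N #272 ∕ ref4 R4-72 (no finding on (D-G); the (V1) kill was (D-CΔ) only): at a wild CM place, for the anchor
vertex lattice `N` of type `t ∈ {{0, 2}}` and its stabiliser `K_t`, the orbital integral of `1_{{K_t}}` over the class of a near-identity regular element `γ = z • Γ` of a four-frame
is a constant `C` (depending on the measures only) times the CENSUS COUNT `fixedVertexCount σ_w ϖ t Γ` (★ #0a §H) — the Kottwitz∕Rogawski lattice-counting dictionary, the
one bridge between the census laws (DEFS LEAF №1) and ★ orbital integrals.  A PROVER TARGET (unit (ii-G) of the price sheet; deal g10-#10), NOT a literature fact as typed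
(the print statement is [Rogawski1990, §4.9] ∕ [Kottwitz1986, §3]; the typed bridge to ★ `classOrbitalIntegral` under canonical measures is ours to prove).

HONEST LABEL: HC_CM is proved only modulo the 7 printed citations (2 remaining: hLiu418 = stmt-HodgeConjecture-24832, h413 = stmt-HodgeConjecture-24833) until rung 0 closes;
this file asserts nothing (count-neutral vehicle).

## References
* [Rogawski1990] J. D. Rogawski, *Automorphic Representations of Unitary Groups in Three Variables*, Ann. of Math. Stud. 123 (1990): Prop. 4.9.1, §4.9 pp. 55–57
  (near-identity orbital integrals as lattice counts), §12.2.
* [Kottwitz1986] R. Kottwitz, *Base change for unit elements of Hecke algebras*, Compositio Math. 60 (1986), §3 (orbital integrals of `1_K` as fixed-lattice counts).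
* [LanglandsShelstad1987] R. P. Langlands, D. Shelstad, *On the definition of transfer factors*, Math. Ann. 278 (1987), §3 (the factor `Δ` near the identity).
-/

noncomputable section

namespace Summit.HodgeConjecture.HodgeConjecture.Cruxes.H413.F0P3cDyRamFourFrameDictionaryDefs

open MeasureTheory Measure NumberField IsDedekindDomain Topology Filter
open Literature.NumberTheory.Automorphic Literature.NumberTheory.Automorphic.UnitaryGroup Literature.NumberTheory.Automorphic.IntegralReduction
open Literature.NumberTheory.Automorphic.UnitaryLatticeTree Literature.NumberTheory.Automorphic.HermitianLattice
open Literature.NumberTheory.Rogawski1990 Literature.NumberTheory.GaloisRepresentations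
open Literature.MeasureTheory.Group (descConj)
open Literature.NumberTheory.Automorphic.UnitaryThreeFourFrame
open scoped Matrix MatrixGroups Classical ValuativeRel WithZero


/-! ## §G  `AnchorCountDictionary` — GATE 1a-1 (D-G) VERBATIM -/

/-- **(D-G) `AnchorCountDictionary t` — THE CENSUS DICTIONARY FOR THE TYPE-`t` ANCHOR PIECE** (unit (ii-G) + (ii-0); NEW).  At a wild ramified non-split place, for the
canonical orbital family `mG₃` and a subgroup `K_t ≤ U(Φ₃)(L⁺_v)` that is the stabiliser of a type-`t` vertex lattice `N` of `(L_w³, Φ₃)` (`t = 0`: `N = 𝒪³`, `K_0 = K` the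
integral level; `t = 2`: `K′`): ONE constant `C_t` such that for every TYPE-(1) near-identity regular literal `γ` — matrix `z·frameElt σ_w f b α β` in a four-frame family,
`α, β, z ∈ E¹`, `α ≠ β`, `α, β ≠ 1` — the orbital integral of `1_{K_t}` at `[γ]` is `C_t ·` the sheet's fixed-vertex count `n_t` of the frame literal `Γ_b`
(H2 `fixedVertexCount`; the norm-one scalar `z` fixes every lattice).  Inside this Prop: transitivity of `U(Φ₃)` on type-`t` vertices (htr_t of (ii-0): `G∕K_t` = the
type-`t` vertices), the coset ↔ lattice dictionary, and the canonical torus volume (one stable class of type-(1) tori ⇒ one constant). -/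
def AnchorCountDictionary (t : ℕ) : Prop :=
    ∀ (L : Type) [Field L] [NumberField L] [IsCMField L]
      {v : HeightOneSpectrum (𝓞 ↥(maximalRealSubfield L))} (w : UnitaryGroup.PlacesOver L v)
      (hw : IsCMField.complexConj L • w.1 = w.1) (_he : v.asIdeal.ramificationIdx' w.1.asIdeal ≠ 1)
      (_h2 : ¬ IsUnit (2 : 𝒪[w.1.adicCompletion L]))
      (ϖ : (w.1.adicCompletion L)) (_hϖ : Valued.v ϖ = WithZero.exp (-1 : ℤ))
      [MeasurableSpace ((UnitaryGroup.cmDatum L 3 (Matrix.of fun i j : Fin 3 => if i.val + j.val + 1 = 3 then (1 : L) else 0)).Local v)] [BorelSpace ((UnitaryGroup.cmDatum L 3 (Matrix.of fun i j : Fin 3 => if i.val + j.val + 1 = 3 then (1 : L) else 0)).Local v)]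
      [∀ γ : ((UnitaryGroup.cmDatum L 3 (Matrix.of fun i j : Fin 3 => if i.val + j.val + 1 = 3 then (1 : L) else 0)).Local v), MeasurableSpace (((UnitaryGroup.cmDatum L 3 (Matrix.of fun i j : Fin 3 => if i.val + j.val + 1 = 3 then (1 : L) else 0)).Local v) ⧸ Subgroup.centralizer ({γ} : Set ((UnitaryGroup.cmDatum L 3 (Matrix.of fun i j : Fin 3 => if i.val + j.val + 1 = 3 then (1 : L) else 0)).Local v)))]
      [∀ γ : ((UnitaryGroup.cmDatum L 3 (Matrix.of fun i j : Fin 3 => if i.val + j.val + 1 = 3 then (1 : L) else 0)).Local v), BorelSpace (((UnitaryGroup.cmDatum L 3 (Matrix.of fun i j : Fin 3 => if i.val + j.val + 1 = 3 then (1 : L) else 0)).Local v) ⧸ Subgroup.centralizer ({γ} : Set ((UnitaryGroup.cmDatum L 3 (Matrix.of fun i j : Fin 3 => if i.val + j.val + 1 = 3 then (1 : L) else 0)).Local v)))]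
      (νG₃ : Measure ((UnitaryGroup.cmDatum L 3 (Matrix.of fun i j : Fin 3 => if i.val + j.val + 1 = 3 then (1 : L) else 0)).Local v)) [νG₃.IsHaarMeasure] [νG₃.IsMulRightInvariant]
      (mG₃ : OrbitalMeasureFamily ((UnitaryGroup.cmDatum L 3 (Matrix.of fun i j : Fin 3 => if i.val + j.val + 1 = 3 then (1 : L) else 0)).Local v)), mG₃.IsCanonical (fun γ => IsRegularElt (γ.val : GL (Fin 3) (UnitaryGroup.LocalRing L v))) νG₃ →
      ∀ (N : Submodule (Valued.integer (w.1.adicCompletion L)) (Fin 3 → (w.1.adicCompletion L))), IsVertexLattice (galAdicCompletionMap (L := L) (IsCMField.complexConj L) hw) ϖ ((StdForm.antidiagonal 3).over (w.1.adicCompletion L)) t N →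
      ∀ (Kt : Subgroup ((UnitaryGroup.cmDatum L 3 (Matrix.of fun i j : Fin 3 => if i.val + j.val + 1 = 3 then (1 : L) else 0)).Local v)), (∀ u : ((UnitaryGroup.cmDatum L 3 (Matrix.of fun i j : Fin 3 => if i.val + j.val + 1 = 3 then (1 : L) else 0)).Local v), u ∈ Kt ↔ mapGL ((localNonsplitEquiv (IsCMField.complexConj L) (Matrix.of fun i j : Fin 3 => if i.val + j.val + 1 = 3 then (1 : L) else 0) (IsCMField.complexConj_ne_one L) w hw u :
              ↥(unitaryGroupOfForm (galAdicCompletionMap (L := L) (IsCMField.complexConj L) hw) (placeForm (Matrix.of fun i j : Fin 3 => if i.val + j.val + 1 = 3 then (1 : L) else 0) w.1))) : GL (Fin 3) (w.1.adicCompletion L)) N = N) →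
      ∃ C : ℂ, ∀ (f : Fin 4 → Fin 3 → (Fin 3 → (w.1.adicCompletion L))), IsFourFrameFamily (galAdicCompletionMap (L := L) (IsCMField.complexConj L) hw) f →
        ∀ (α β z : (w.1.adicCompletion L)), α * (galAdicCompletionMap (L := L) (IsCMField.complexConj L) hw) α = 1 → β * (galAdicCompletionMap (L := L) (IsCMField.complexConj L) hw) β = 1 → z * (galAdicCompletionMap (L := L) (IsCMField.complexConj L) hw) z = 1 → α ≠ β → α ≠ 1 → β ≠ 1 →
        ∀ (b : Fin 4) (Γ : GL (Fin 3) (w.1.adicCompletion L)), (Γ : Matrix (Fin 3) (Fin 3) (w.1.adicCompletion L)) = frameElt (galAdicCompletionMap (L := L) (IsCMField.complexConj L) hw) f b α β →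
        ∀ (γ : ((UnitaryGroup.cmDatum L 3 (Matrix.of fun i j : Fin 3 => if i.val + j.val + 1 = 3 then (1 : L) else 0)).Local v)), ((((localNonsplitEquiv (IsCMField.complexConj L) (Matrix.of fun i j : Fin 3 => if i.val + j.val + 1 = 3 then (1 : L) else 0) (IsCMField.complexConj_ne_one L) w hw γ :
              ↥(unitaryGroupOfForm (galAdicCompletionMap (L := L) (IsCMField.complexConj L) hw) (placeForm (Matrix.of fun i j : Fin 3 => if i.val + j.val + 1 = 3 then (1 : L) else 0) w.1))) : GL (Fin 3) (w.1.adicCompletion L)) : Matrix (Fin 3) (Fin 3) (w.1.adicCompletion L))) = z • (Γ : Matrix (Fin 3) (Fin 3) (w.1.adicCompletion L)) →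
          classOrbitalIntegral mG₃ (Set.indicator (Kt : Set ((UnitaryGroup.cmDatum L 3 (Matrix.of fun i j : Fin 3 => if i.val + j.val + 1 = 3 then (1 : L) else 0)).Local v)) (fun _ => (1 : ℂ))) (ConjClasses.mk γ) = C * (fixedVertexCount (galAdicCompletionMap (L := L) (IsCMField.complexConj L) hw) ϖ t Γ : ℂ)

end Summit.HodgeConjecture.HodgeConjecture.Cruxes.H413.F0P3cDyRamFourFrameDictionaryDefs

end
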